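import Mathlib.Data.Matrix.Block
import Mathlib.Data.Matrix.ColumnRowPartitioned
import Mathlib.LinearAlgebra.Matrix.SemiringInverse
import Mathlib.LinearAlgebra.Matrix.Notation
import Mathlib.Tactic.FinCases
import Mathlib.Tactic.LinearCombination
import Mathlib.Tactic.NoncommRing
import HarnessLib

/-!
# Orlov's isometric isomorphisms in the lattice model `Λ = Γ ⊕ Γ*`: Prop. 2.21 (`f ∈ U ⟺ Fᵗ Q_B F = Q_A`) and
# the two identities of Construction 4.10 (`ĝ = g`; `z − w y⁻¹ x = −ŷ⁻¹`, i.e. `Φ_μ = (1, −1, 1, 1)Γ`)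

Venture cell `pub-hsemireg` (Lean root `Summits/Ventures/HSemireg/`), literature seat `lit-w-polishchuk-orlov`
(g12, 2026-08-25). Companion of `OrlovIsometryGroupCMBlockModel.lean` (g7: the POLARISED model `Â = A`, hat = Rosati
transpose, Gram matrix `J = (0 1; −1 0)`) and of `KapustinOrlovToriComplexStructures.lean` (g12: Kapustin–Orlov's
operators, orthogonal for the SAME symmetric form `q = (0 1; 1 0)` used here); neither is imported.

PRINTED ([Orlov2002DerivedAbelian] = D. O. Orlov, «Derived categories of coherent sheaves on abelian varieties and
equivalences between them», Izv. Math. 66:3 (2002) 569–594; quoted from the author's arXiv text alg-geom/9712017v4,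
whose item numbers are the journal's; page images read 2026-08-25, `widen/LIT-W/texts-po/BYEYE-LOG-g12-orl02-…`):
* p. 14 (before Def. 2.17): a morphism `f : A × Â → B × B̂` is a matrix `(α β; γ δ)`, «where the morphism `α` maps `A`
  to `B`, `β` maps `Â` to `B`, `γ` maps `A` to `B̂`, and `δ` maps `Â` to `B̂`», `f̃ := (δ̂ −β̂; −γ̂ α̂)`,
  `U(A × Â, B × B̂) := {f ∈ Iso(A × Â, B × B̂) ∣ f̃ = f⁻¹}`; Def. 2.17: such `f` are called ISOMETRIC.
* Rem. 2.3 (`k = ℂ`, p. 7): for `f : A → B` with dual bases in `H₁(Â), H₁(B̂)` «the matrix `F̂` is transposed to `F`»;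
  for `f : A → Â` «the matrices `F` and `F̂` are skew-transposed to each other, that is, `F̂ = −Fᵗ`»; Rem. 2.2: «The
  sign “minus” appears because the forms `c₁(P_A)` and `c₁(P_Â)` are skew-symmetric.»
* p. 15: on `Γ ⊕ Γ*` the «canonical symmetric bilinear form `Q((x, l), (y, m)) = l(y) + m(x)`»; PROP. 2.21: «An
  isomorphism `f : A × Â → B × B̂` belongs to `U(A × Â, B × B̂)` if and only if it determines an isometry of the
  lattices `(Λ_A, Q_A)` and `(Λ_B, Q_B)`, that is, `Fᵗ Q_B F = Q_A`, where `F : Λ_A → Λ_B` is the map induced by `f` on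
  the first homology. The proof is obtained by a direct matrix computation using Remark 2.3.»
* CONSTRUCTION 4.10 (p. 20; `k = k̄`, `char k = 0`): «We fix an isometric isomorphism `f : A × Â → B × B̂` and denote
  its graph by `Γ`. … `f = (x y; z w)`. Suppose that `y : Â → B` is an isogeny. Then the map `f` determines an element
  `g ∈ Hom(A × B, Â × B̂) ⊗_ℤ ℚ` by the formula `g = (y⁻¹x −y⁻¹; −ŷ⁻¹ wy⁻¹)`. … Since `f` is isometric, we easily
  verify that `ĝ = g`. This means that `g` actually belongs to the image of `NS(A × B) ⊗_ℤ ℚ`»; p. 21: «If a point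
  `(a, α, b, β)` belongs to `Γ`, then `b = x(a) + y(α)`, `β = z(a) + w(α)` and, therefore, `α = −y⁻¹x(a) + y⁻¹(b)`,
  `β = (z − wy⁻¹x)(a) + wy⁻¹(b)`. Since `f` is isometric, we have `(z − wy⁻¹x) = −ŷ⁻¹`. Hence the point `(a, α, b, β)`
  belongs to `Γ` if and only if `(a, −α, b, β)` belongs to `Φ_μ`. We thus find that `Φ_μ = (1_A, −1_Â, 1_B, 1_B̂)Γ`.»
  (p. 21 L1–2: «there is `μ = [L]/l ∈ NS(A × B)` such that `Φ_μ` coincides with the graph of the correspondence `g`»,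
  `Φ_μ := Im[D → D × D̂, (l, φ_L)]` p. 19; the identity is re-used in the proof of Prop. 4.12, p. 22.)

MODEL (the one modelling step, ASSUMED — it is Rem. 2.3's dictionary): `A` and `B` have the same dimension (they do
when `A × Â ≅ B × B̂`); bases of `Γ_A = H₁(A, ℤ)`, `Γ_B` and the DUAL bases of `Γ_A* = H₁(Â, ℤ)`, `Γ_B*` are fixed and
indexed by one finite type `n`; the blocks `x, y, z, w` of `f` become `n × n` matrices `X, Y, Z, W` over a commutative
ring `R` (read `ℤ`; `ℚ` where `y⁻¹` occurs), so `F = fromBlocks X Y Z W` acts on `Λ_A = Γ_A ⊕ Γ_A*`; hats are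
`[α̂] = Xᵀ`, `[δ̂] = Wᵀ` (variety → variety, dual → dual: transpose) and `[β̂] = −Yᵀ`, `[γ̂] = −Zᵀ` (between a variety
and a dual: minus transpose), hence `[f̃] = (Wᵀ Yᵀ; Zᵀ Xᵀ)`, `[−ŷ⁻¹] = (Y⁻¹)ᵀ`, and `Q = q := fromBlocks 0 1 1 0`. A
homomorphism `A × B → Â × B̂` «comes from `NS ⊗ ℚ`», i.e. satisfies `ĝ = g`, iff its matrix `G : Γ_A ⊕ Γ_B → Γ_A* ⊕
Γ_B*` is skew (`Gᵀ = −G`, Rem. 2.2). Points `(a, α)` of `A × Â` are modelled by column blocks `fromRows a α` with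
`a, α : Matrix n k R` (any `k`; `k = Unit` = one vector). Nothing below uses more than this dictionary.

## Results (PROVED; theorems only — no `def`, no named fact, no `sorry`; imports Mathlib + HarnessLib)
* `q_mul_q`, `q_transpose`; `tilde_eq`: **`q Fᵀ q = (Wᵀ Yᵀ; Zᵀ Xᵀ) = [f̃]`** — Rem. 2.3's dictionary makes Orlov's
  `f̃` the `q`-adjoint of `F`.
* `isometric_iff`: **`[f̃] F = 1 ⟺ Fᵀ q F = q`** — PROP. 2.21 in the model (its «direct matrix computation»);
  `isometric_iff_blocks`: `⟺ WᵀX + YᵀZ = 1 ∧ WᵀY + YᵀW = 0 ∧ ZᵀX + XᵀZ = 0 ∧ ZᵀY + XᵀW = 1`;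
  `tilde_mul_comm` (`[f̃] F = 1 ⟺ F [f̃] = 1`, square matrices over a commutative ring), `isometric_iff_blocks'`
  (`F [f̃] = 1 ⟺ XWᵀ + YZᵀ = 1 ∧ XYᵀ + YXᵀ = 0 ∧ ZWᵀ + WZᵀ = 0 ∧ ZYᵀ + WXᵀ = 1`), `isometric_flip`
  (`Fᵀ q F = q ⟺ F q Fᵀ = q`); `isometric_one`, `isometric_mul`, `isometric_tilde` («`U(A × Â)` is a subgroup in
  `Aut(A × Â)`», p. 14, and `f̃ ∈ U(B × B̂, A × Â)`). DERIVED HERE in the model.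
* `schur_eq` (Constr. 4.10, p. 21): **`Fᵀ q F = q`, `Y Y' = 1 ⟹ Z − W Y' X = Y'ᵀ`** (`= [−ŷ⁻¹]`).
* `correspondence_transpose` (Constr. 4.10, p. 20 «`ĝ = g`»): for `Fᵀ q F = q`, `Y'Y = 1 = YY'` the matrix
  **`G = (Y'X −Y'; Y'ᵀ WY')`** of `g` **is skew: `Gᵀ = −G`**.
* `graph_iff_correspondence` (p. 21 «`Φ_μ = (1_A, −1_Â, 1_B, 1_B̂)Γ`»): under the same hypotheses, for all column
  blocks `a α b β`, **`F (a; α) = (b; β) ⟺ G (a; b) = (−α; β)`**.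
* Non-vacuity over `ℤ` (`n = Fin 2`): `example_isometric` — `X = W = (0 1; −1 0)`, `Y = 1`, `Z = 0` give an isometric
  `F` with `Y` invertible, `Z − WY⁻¹X = 1 = (Y⁻¹)ᵀ` and a skew `G`, checked by `decide`; `example_SL2_isometric` —
  Ex. 4.16 (`N = 1`) in the model: for `ad − bc = 1`, `f = (a, bφ_L⁻¹; cφ_L, d)` on `E × Ê` (`[φ_L] = (0 1; −1 0)`)
  satisfies `[f̃] F = 1`, i.e. `SL(2, ℤ) ⊆ U(E × Ê)` (the reverse inclusion is the companion `2 × 2` model's).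

HONEST FRAMING: block-matrix identities over a commutative ring, i.e. Prop. 2.21's criterion and Construction 4.10's
two «easily verified» identities written out in Rem. 2.3's coordinates; DERIVED HERE (rule R3: the displayed
sentences above are the only quotations). The modelling dictionary is an assumption of the model, not a theorem;
nothing here constructs an abelian variety, a semihomogeneous bundle, `Φ_μ`, `NS`, or a derived equivalence
(Props. 4.11–4.12, Thm. 4.13 are cited only), and nothing here says that HC, HC_CM or HC_AV holds.
-/

namespace Summit.Ventures.HSemireg.OrlovLattice

open Matrix

variable {R : Type*} [CommRing R] {n : Type*} [Fintype n] [DecidableEq n]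

/-! ## The form `q = (0 1; 1 0)` and Orlov's `f̃` -/

/-- `q² = 1` for `q = (0 1; 1 0)` in `n × n` blocks. [folklore] -/
theorem q_mul_q : (fromBlocks 0 1 1 0 : Matrix (n ⊕ n) (n ⊕ n) R) * fromBlocks 0 1 1 0 = 1 := by
  simp [fromBlocks_multiply, ← fromBlocks_one]

omit [Fintype n] in
/-- `q` is symmetric. [folklore] -/
theorem q_transpose : (fromBlocks 0 1 1 0 : Matrix (n ⊕ n) (n ⊕ n) R)ᵀ = fromBlocks 0 1 1 0 := by
  simp [fromBlocks_transpose]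

/-- **`[f̃] = q Fᵀ q`.** With Rem. 2.3's dictionary (`[α̂] = Xᵀ`, `[δ̂] = Wᵀ`, `[β̂] = −Yᵀ`, `[γ̂] = −Zᵀ`) Orlov's
`f̃ = (δ̂ −β̂; −γ̂ α̂)` [cite: Orlov2002DerivedAbelian, p. 14 before Def 2.17] has matrix `(Wᵀ Yᵀ; Zᵀ Xᵀ)`, which is the
`q`-adjoint `q Fᵀ q` of `F = (X Y; Z W)`. DERIVED HERE (model). -/
theorem tilde_eq (X Y Z W : Matrix n n R) :
    (fromBlocks 0 1 1 0 : Matrix (n ⊕ n) (n ⊕ n) R) * (fromBlocks X Y Z W)ᵀ * fromBlocks 0 1 1 0 =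
      fromBlocks Wᵀ Yᵀ Zᵀ Xᵀ := by
  simp [fromBlocks_transpose, fromBlocks_multiply]

/-! ## Prop. 2.21: `f̃ = f⁻¹ ⟺ Fᵗ Q F = Q` -/

/-- **PROP. 2.21 in the model: `[f̃] · F = 1 ⟺ Fᵀ q F = q`** («`f` belongs to `U(A × Â, B × B̂)` if and only if …
`Fᵗ Q_B F = Q_A` … direct matrix computation using Remark 2.3» [cite: Orlov2002DerivedAbelian, Prop 2.21]). The printed
`f̃ = f⁻¹` is two-sided; for square matrices over a commutative ring the one-sided form loses nothing
(`tilde_mul_comm`). DERIVED HERE (model). -/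
theorem isometric_iff (X Y Z W : Matrix n n R) :
    fromBlocks Wᵀ Yᵀ Zᵀ Xᵀ * fromBlocks X Y Z W = 1 ↔
      (fromBlocks X Y Z W)ᵀ * (fromBlocks 0 1 1 0 : Matrix (n ⊕ n) (n ⊕ n) R) * fromBlocks X Y Z W = fromBlocks 0 1 1 0 := by
  rw [← tilde_eq X Y Z W]
  set F := fromBlocks X Y Z W
  set q := (fromBlocks 0 1 1 0 : Matrix (n ⊕ n) (n ⊕ n) R) with hq
  have hqq : q * q = 1 := q_mul_q
  constructor
  · intro h
    calc Fᵀ * q * F = (q * q) * (Fᵀ * q * F) := by rw [hqq, Matrix.one_mul]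
      _ = q * (q * Fᵀ * q * F) := by simp only [Matrix.mul_assoc]
      _ = q := by rw [h, Matrix.mul_one]
  · intro h
    calc q * Fᵀ * q * F = q * (Fᵀ * q * F) := by simp only [Matrix.mul_assoc]
      _ = 1 := by rw [h, hqq]

/-- **Block form of `[f̃] F = 1`**: `WᵀX + YᵀZ = 1`, `WᵀY + YᵀW = 0`, `ZᵀX + XᵀZ = 0`, `ZᵀY + XᵀW = 1`. DERIVED HERE. -/
theorem isometric_iff_blocks (X Y Z W : Matrix n n R) :
    fromBlocks Wᵀ Yᵀ Zᵀ Xᵀ * fromBlocks X Y Z W = 1 ↔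
      Wᵀ * X + Yᵀ * Z = 1 ∧ Wᵀ * Y + Yᵀ * W = 0 ∧ Zᵀ * X + Xᵀ * Z = 0 ∧ Zᵀ * Y + Xᵀ * W = 1 := by
  rw [fromBlocks_multiply, ← fromBlocks_one, fromBlocks_inj]

/-- `[f̃] F = 1 ⟺ F [f̃] = 1` (square matrices over a commutative ring are Dedekind-finite). [folklore] -/
theorem tilde_mul_comm (X Y Z W : Matrix n n R) :
    fromBlocks Wᵀ Yᵀ Zᵀ Xᵀ * fromBlocks X Y Z W = 1 ↔ fromBlocks X Y Z W * fromBlocks Wᵀ Yᵀ Zᵀ Xᵀ = 1 :=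
  mul_eq_one_comm

/-- **Block form of `F [f̃] = 1`**: `XWᵀ + YZᵀ = 1`, `XYᵀ + YXᵀ = 0`, `ZWᵀ + WZᵀ = 0`, `ZYᵀ + WXᵀ = 1`. DERIVED HERE. -/
theorem isometric_iff_blocks' (X Y Z W : Matrix n n R) :
    fromBlocks X Y Z W * fromBlocks Wᵀ Yᵀ Zᵀ Xᵀ = 1 ↔
      X * Wᵀ + Y * Zᵀ = 1 ∧ X * Yᵀ + Y * Xᵀ = 0 ∧ Z * Wᵀ + W * Zᵀ = 0 ∧ Z * Yᵀ + W * Xᵀ = 1 := by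
  rw [fromBlocks_multiply, ← fromBlocks_one, fromBlocks_inj]

/-- `Fᵀ q F = q ⟺ F q Fᵀ = q` for any `F` on `Γ ⊕ Γ*` (so `f ∈ U ⟹` the transpose relations hold too). [folklore] -/
theorem isometric_flip (F : Matrix (n ⊕ n) (n ⊕ n) R) :
    Fᵀ * (fromBlocks 0 1 1 0 : Matrix (n ⊕ n) (n ⊕ n) R) * F = fromBlocks 0 1 1 0 ↔
      F * (fromBlocks 0 1 1 0 : Matrix (n ⊕ n) (n ⊕ n) R) * Fᵀ = fromBlocks 0 1 1 0 := by
  set q := (fromBlocks 0 1 1 0 : Matrix (n ⊕ n) (n ⊕ n) R) with hq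
  have hqq : q * q = 1 := q_mul_q
  have step1 : Fᵀ * q * F = q ↔ (q * Fᵀ * q) * F = 1 := by
    constructor
    · intro h
      calc q * Fᵀ * q * F = q * (Fᵀ * q * F) := by simp only [Matrix.mul_assoc]
        _ = 1 := by rw [h, hqq]
    · intro h
      calc Fᵀ * q * F = (q * q) * (Fᵀ * q * F) := by rw [hqq, Matrix.one_mul]
        _ = q * (q * Fᵀ * q * F) := by simp only [Matrix.mul_assoc]
        _ = q := by rw [h, Matrix.mul_one]
  have step2 : F * q * Fᵀ = q ↔ F * (q * Fᵀ * q) = 1 := by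
    constructor
    · intro h
      calc F * (q * Fᵀ * q) = (F * q * Fᵀ) * q := by simp only [Matrix.mul_assoc]
        _ = 1 := by rw [h, hqq]
    · intro h
      calc F * q * Fᵀ = (F * q * Fᵀ) * (q * q) := by rw [hqq, Matrix.mul_one]
        _ = (F * (q * Fᵀ * q)) * q := by simp only [Matrix.mul_assoc]
        _ = q := by rw [h, Matrix.one_mul]
  rw [step1, step2]
  exact mul_eq_one_comm

/-! ## `U` is closed under `1`, products and `f ↦ f̃` -/

/-- `1 ∈ U`. [folklore] -/
theorem isometric_one :
    (1 : Matrix (n ⊕ n) (n ⊕ n) R)ᵀ * (fromBlocks 0 1 1 0 : Matrix (n ⊕ n) (n ⊕ n) R) * 1 = fromBlocks 0 1 1 0 := by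
  simp

/-- `U` is closed under composition («`U(A × Â)` is a subgroup in `Aut(A × Â)`» [cite: Orlov2002DerivedAbelian,
p. 14]); in the model: `q`-isometries compose. [folklore] -/
theorem isometric_mul {F G : Matrix (n ⊕ n) (n ⊕ n) R}
    (hF : Fᵀ * (fromBlocks 0 1 1 0 : Matrix (n ⊕ n) (n ⊕ n) R) * F = fromBlocks 0 1 1 0)
    (hG : Gᵀ * (fromBlocks 0 1 1 0 : Matrix (n ⊕ n) (n ⊕ n) R) * G = fromBlocks 0 1 1 0) :
    (F * G)ᵀ * (fromBlocks 0 1 1 0 : Matrix (n ⊕ n) (n ⊕ n) R) * (F * G) = fromBlocks 0 1 1 0 := by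
  rw [Matrix.transpose_mul]
  calc Gᵀ * Fᵀ * fromBlocks 0 1 1 0 * (F * G) = Gᵀ * (Fᵀ * fromBlocks 0 1 1 0 * F) * G := by
        simp only [Matrix.mul_assoc]
    _ = fromBlocks 0 1 1 0 := by rw [hF, hG]

/-- `f ∈ U(A × Â, B × B̂) ⟹ f̃ ∈ U(B × B̂, A × Â)`; in the model: `F` a `q`-isometry `⟹ q Fᵀ q` is one. [folklore] -/
theorem isometric_tilde {F : Matrix (n ⊕ n) (n ⊕ n) R}
    (hF : Fᵀ * (fromBlocks 0 1 1 0 : Matrix (n ⊕ n) (n ⊕ n) R) * F = fromBlocks 0 1 1 0) :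
    ((fromBlocks 0 1 1 0 : Matrix (n ⊕ n) (n ⊕ n) R) * Fᵀ * fromBlocks 0 1 1 0)ᵀ * (fromBlocks 0 1 1 0 : Matrix (n ⊕ n) (n ⊕ n) R) *
      ((fromBlocks 0 1 1 0 : Matrix (n ⊕ n) (n ⊕ n) R) * Fᵀ * fromBlocks 0 1 1 0) = fromBlocks 0 1 1 0 := by
  set q := (fromBlocks 0 1 1 0 : Matrix (n ⊕ n) (n ⊕ n) R) with hq
  have hqq : q * q = 1 := q_mul_q
  have hqt : qᵀ = q := q_transpose
  have hF' : F * q * Fᵀ = q := (isometric_flip F).1 hF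
  rw [Matrix.transpose_mul, Matrix.transpose_mul, Matrix.transpose_transpose, hqt]
  calc q * (F * q) * q * (q * Fᵀ * q) = q * (F * q) * (q * q) * Fᵀ * q := by simp only [Matrix.mul_assoc]
    _ = q * (F * q * Fᵀ) * q := by rw [hqq]; simp only [Matrix.mul_assoc, Matrix.mul_one]
    _ = q := by rw [hF', hqq, Matrix.one_mul]

/-! ## Construction 4.10: `z − w y⁻¹ x = −ŷ⁻¹`, `ĝ = g`, and `Φ_μ = (1, −1, 1, 1)Γ` -/

section Construction

variable {X Y Z W Y' : Matrix n n R}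

/-- **`z − w y⁻¹ x = −ŷ⁻¹`** ([cite: Orlov2002DerivedAbelian, Constr 4.10, p. 21] «Since `f` is isometric, we have
`(z − wy⁻¹x) = −ŷ⁻¹`»): in the model, if `F = (X Y; Z W)` is a `q`-isometry and `Y'` has `Y Y' = 1`,
then `Z − W Y' X = Y'ᵀ` (`= [−ŷ⁻¹]`, as `[ŷ] = −Yᵀ`); only `Y Y' = 1` is used. DERIVED HERE. -/
theorem schur_eq
    (hF : (fromBlocks X Y Z W)ᵀ * (fromBlocks 0 1 1 0 : Matrix (n ⊕ n) (n ⊕ n) R) * fromBlocks X Y Z W = fromBlocks 0 1 1 0)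
    (hY' : Y * Y' = 1) : Z - W * Y' * X = Y'ᵀ := by
  obtain ⟨h1, h2, -, -⟩ := (isometric_iff_blocks X Y Z W).1 ((isometric_iff X Y Z W).2 hF)
  have hYt : Y'ᵀ * Yᵀ = 1 := by rw [← Matrix.transpose_mul, hY', Matrix.transpose_one]
  have e1 : Yᵀ * Z = 1 - Wᵀ * X := by rw [← h1]; abel
  have e2 : Yᵀ * W = -(Wᵀ * Y) := eq_neg_of_add_eq_zero_right h2
  have key : Yᵀ * (Z - W * Y' * X) = 1 := by
    calc Yᵀ * (Z - W * Y' * X) = Yᵀ * Z - Yᵀ * W * Y' * X := by noncomm_ring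
      _ = 1 - Wᵀ * X + Wᵀ * (Y * Y') * X := by rw [e1, e2]; noncomm_ring
      _ = 1 := by rw [hY', Matrix.mul_one]; abel
  calc Z - W * Y' * X = Y'ᵀ * Yᵀ * (Z - W * Y' * X) := by rw [hYt, Matrix.one_mul]
    _ = Y'ᵀ := by rw [Matrix.mul_assoc, key, Matrix.mul_one]

/-- **`ĝ = g`** ([cite: Orlov2002DerivedAbelian, Constr 4.10, p. 20] «Since `f` is isometric, we easily verify that
`ĝ = g`. This means that `g` actually belongs to the image of `NS(A × B) ⊗_ℤ ℚ`»): in the model the matrix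
`G = (Y'X −Y'; Y'ᵀ WY')` of `g = (y⁻¹x −y⁻¹; −ŷ⁻¹ wy⁻¹)` is SKEW, `Gᵀ = −G` (Rem. 2.2/2.3: `ĝ = g` for
`g : D → D̂ ⟺ [g]` skew). DERIVED HERE. -/
theorem correspondence_transpose
    (hF : (fromBlocks X Y Z W)ᵀ * (fromBlocks 0 1 1 0 : Matrix (n ⊕ n) (n ⊕ n) R) * fromBlocks X Y Z W = fromBlocks 0 1 1 0)
    (hY : Y' * Y = 1) (hY' : Y * Y' = 1) :
    (fromBlocks (Y' * X) (-Y') Y'ᵀ (W * Y'))ᵀ = -fromBlocks (Y' * X) (-Y') Y'ᵀ (W * Y') := by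
  have hI := (isometric_iff X Y Z W).2 hF
  obtain ⟨-, h2, -, -⟩ := (isometric_iff_blocks X Y Z W).1 hI
  obtain ⟨-, h2', -, -⟩ := (isometric_iff_blocks' X Y Z W).1 ((tilde_mul_comm X Y Z W).1 hI)
  have t1 : Yᵀ * Y'ᵀ = 1 := by rw [← Matrix.transpose_mul, hY, Matrix.transpose_one]
  have t2 : Y'ᵀ * Yᵀ = 1 := by rw [← Matrix.transpose_mul, hY', Matrix.transpose_one]
  have a1 : Xᵀ * Y'ᵀ = -(Y' * X) := by
    have h0 : Y' * (X * Yᵀ + Y * Xᵀ) * Y'ᵀ = 0 := by rw [h2', Matrix.mul_zero, Matrix.zero_mul]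
    have e : Y' * (X * Yᵀ + Y * Xᵀ) * Y'ᵀ = Y' * X * (Yᵀ * Y'ᵀ) + (Y' * Y) * (Xᵀ * Y'ᵀ) := by noncomm_ring
    rw [e, t1, hY, Matrix.mul_one, Matrix.one_mul] at h0
    exact eq_neg_of_add_eq_zero_right h0
  have a2 : Y'ᵀ * Wᵀ = -(W * Y') := by
    have h0 : Y'ᵀ * (Wᵀ * Y + Yᵀ * W) * Y' = 0 := by rw [h2, Matrix.mul_zero, Matrix.zero_mul]
    have e : Y'ᵀ * (Wᵀ * Y + Yᵀ * W) * Y' = Y'ᵀ * Wᵀ * (Y * Y') + (Y'ᵀ * Yᵀ) * (W * Y') := by noncomm_ring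
    rw [e, hY', t2, Matrix.mul_one, Matrix.one_mul] at h0
    exact eq_neg_of_add_eq_zero_left h0
  rw [fromBlocks_transpose, fromBlocks_neg, Matrix.transpose_transpose, Matrix.transpose_neg, Matrix.transpose_mul,
    Matrix.transpose_mul, a1, a2, neg_neg]

/-- **`Φ_μ = (1_A, −1_Â, 1_B, 1_B̂)Γ`** ([cite: Orlov2002DerivedAbelian, Constr 4.10, p. 21] «the point `(a, α, b, β)`
belongs to `Γ` if and only if `(a, −α, b, β)` belongs to `Φ_μ`»; re-used in the proof of Prop. 4.12, p. 22): in the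
model, for column blocks `a, α, b, β` (`Matrix n k R`, any `k`), `F (a; α) = (b; β) ⟺ G (a; b) = (−α; β)` with
`F = (X Y; Z W)`, `G = (Y'X −Y'; Y'ᵀ WY')`. DERIVED HERE. -/
theorem graph_iff_correspondence {k : Type*}
    (hF : (fromBlocks X Y Z W)ᵀ * (fromBlocks 0 1 1 0 : Matrix (n ⊕ n) (n ⊕ n) R) * fromBlocks X Y Z W = fromBlocks 0 1 1 0)
    (hY : Y' * Y = 1) (hY' : Y * Y' = 1) (a α b β : Matrix n k R) :
    fromBlocks X Y Z W * fromRows a α = fromRows b β ↔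
      fromBlocks (Y' * X) (-Y') Y'ᵀ (W * Y') * fromRows a b = fromRows (-α) β := by
  have hS : Z - W * Y' * X = Y'ᵀ := schur_eq hF hY'
  have hWY : W * Y' * Y = W := by rw [Matrix.mul_assoc, hY, Matrix.mul_one]
  rw [fromBlocks_mul_fromRows, fromBlocks_mul_fromRows, fromRows_ext_iff, fromRows_ext_iff]
  constructor
  · rintro ⟨hb, hβ⟩
    refine ⟨?_, ?_⟩
    · rw [← hb]
      simp only [Matrix.neg_mul, Matrix.mul_add, ← Matrix.mul_assoc, hY, Matrix.one_mul]
      abel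
    · rw [← hb, ← hβ, ← hS]
      simp only [Matrix.sub_mul, Matrix.mul_add, ← Matrix.mul_assoc]
      rw [hWY]
      abel
  · rintro ⟨hα, hβ⟩
    have e : Y * (Y' * X * a + -Y' * b) = Y * -α := by rw [hα]
    simp only [Matrix.mul_add, Matrix.mul_neg, Matrix.neg_mul, ← Matrix.mul_assoc, hY', Matrix.one_mul] at e
    -- e : X * a + -b = -(Y * α)
    have hb : X * a + Y * α = b := by
      rw [← sub_eq_zero]
      have e3 : X * a + -b + Y * α = 0 := by rw [e]; exact neg_add_cancel (Y * α)
      rw [← e3]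
      abel
    refine ⟨hb, ?_⟩
    rw [← hβ, ← hS, ← hb]
    simp only [Matrix.sub_mul, Matrix.mul_add, ← Matrix.mul_assoc]
    rw [hWY]
    abel

end Construction

/-! ## Non-vacuity over `ℤ` -/

/-- Over `ℤ` with `n = Fin 2`: `X = W = (0 1; −1 0)`, `Y = 1`, `Z = 0` give a `q`-isometry `F = (X Y; Z W)` with `Y`
invertible (`Y⁻¹ = 1`); there `Z − W Y⁻¹ X = 1 = (Y⁻¹)ᵀ` and `G = (X −1; 1 W)` is skew — the hypotheses of
`schur_eq` ∕ `correspondence_transpose` ∕ `graph_iff_correspondence` are met non-trivially. Checked by `decide`. -/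
theorem example_isometric :
    (fromBlocks !![0, 1; -1, 0] 1 0 !![0, 1; -1, 0] : Matrix (Fin 2 ⊕ Fin 2) (Fin 2 ⊕ Fin 2) ℤ)ᵀ *
          fromBlocks 0 1 1 0 * fromBlocks !![0, 1; -1, 0] 1 0 !![0, 1; -1, 0] = fromBlocks 0 1 1 0 ∧
      (0 : Matrix (Fin 2) (Fin 2) ℤ) - !![0, 1; -1, 0] * 1 * !![0, 1; -1, 0] = (1 : Matrix (Fin 2) (Fin 2) ℤ)ᵀ ∧
      (fromBlocks (1 * !![0, 1; -1, 0]) (-1) (1 : Matrix (Fin 2) (Fin 2) ℤ)ᵀ (!![0, 1; -1, 0] * 1) :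
          Matrix (Fin 2 ⊕ Fin 2) (Fin 2 ⊕ Fin 2) ℤ)ᵀ =
        -fromBlocks (1 * !![0, 1; -1, 0]) (-1) (1 : Matrix (Fin 2) (Fin 2) ℤ)ᵀ (!![0, 1; -1, 0] * 1) := by
  refine ⟨?_, ?_, ?_⟩ <;> decide

/-- **Ex. 4.16, `N = 1`, in the model: `SL(2, ℤ) ⊆ U(E × Ê)`.** For an elliptic curve `E` (`Γ = H₁(E, ℤ) = ℤ²`) with
principal polarisation `φ_L : E ⥲ Ê`, whose matrix in a symplectic basis and its dual is the alternating form
`Φ = (0 1; −1 0) = c₁(L)` (so `[φ̂_L] = −Φᵀ = Φ`: «a map `φ : D → D̂` belongs to the image of `NS(D)` if and only if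
`φ̂ = φ`», p. 18), Orlov's `f = (a · 1, b · φ_L⁻¹; c · φ_L, d · 1)` with `ad − bc = 1` has blocks `X = a · 1`,
`Y = b · Φ⁻¹ = (0 −b; b 0)`, `Z = c · Φ = (0 c; −c 0)`, `W = d · 1`, and `[f̃] F = 1`: the inclusion `SL(2, ℤ) ⊆ U(E × Ê)`
behind «the group `U(A × Â)` is isomorphic to `SL(2, ℤ)`» [cite: Orlov2002DerivedAbelian, Ex 4.16] (principally
polarised, `End A = ℤ`). The reverse inclusion uses `End E = ℤ` and is the `2 × 2` model of the companion file
`OrlovIsometryGroupCM.lean` (`orlovIsometric_ringHomId_iff_det`); it is not re-proved here. DERIVED HERE (model). -/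
theorem example_SL2_isometric (a b c d : ℤ) (h : a * d - b * c = 1) :
    (fromBlocks !![d, 0; 0, d]ᵀ !![0, -b; b, 0]ᵀ !![0, c; -c, 0]ᵀ !![a, 0; 0, a]ᵀ :
        Matrix (Fin 2 ⊕ Fin 2) (Fin 2 ⊕ Fin 2) ℤ) *
      fromBlocks !![a, 0; 0, a] !![0, -b; b, 0] !![0, c; -c, 0] !![d, 0; 0, d] = 1 := by
  rw [fromBlocks_multiply, ← fromBlocks_one, fromBlocks_inj]
  refine ⟨?_, ?_, ?_, ?_⟩
  all_goals
    ext i j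
    fin_cases i <;> fin_cases j <;> simp [Matrix.mul_apply, Fin.sum_univ_two] <;> first | ring1 | linear_combination h

end Summit.Ventures.HSemireg.OrlovLattice
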